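import Summits.Ventures.CertifiedArithmetic.LowPrec.OptTreePolySignedRefutation
import Summits.Ventures.CertifiedArithmetic.LowPrec.OptTreePolySignedUpper
import Summits.Ventures.CertifiedArithmetic.LowPrec.OptTreePolySignedHeight

/-!
# Opt / CM-T — Theorem T4(e) settled: Statement-style R4 propositions for signed data

HONEST FRAMING (venture CertifiedArithmetic / cell `pub-lowprec`): certified error envelopes and
provably optimal rounding/accumulation schemes for low-precision formats under stated cost models;
every table by two implementations; no hardware or vendor claims.

`Summits/Ventures/CertifiedArithmetic/Statement.lean` is at the gate's line cap, so — like
`OptTreeR4.lean` for Theorem T3 — the Statement-style propositions settling OPTIMA.md §T Theorem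
T4(e) (signed data) are recorded HERE in the `R4_*` / `R4_*_holds` shape, each discharged sorry-free
by the landed files:
* `R4_SignedTreePolyLawFalse` — Conjecture S is false: for every `c > 0` some format and some
  in-range summation tree with `(n-1)u ≤ c` have two-sided error ABOVE `(1 - 1/M_t(u))·Σ|xᵢ|`
  (`OptTreePolySignedRefutation.signed_law_fails_below_any_threshold`; per format:
  `signed_law_fails`, nine summands, every precision `p ≥ 4`);
* `R4_SignedTreePolyUpper` — what holds instead, for EVERY format (`m ≥ 1`), every in-range tree of
  signed data, every `n`: `|ŝ - s| ≤ (M_t(u/(1+u)) - 1)·Σ|xᵢ|`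
  (`OptTreePolySignedUpper.abs_eval_sub_exact_le_treeM_format`);
so the exact signed worst case of every tree lies in `[1 - 1/M_t(u), M_t(u/(1+u)) - 1]` (lower end
attained by nonnegative data, `R4_TreePolyFormats`; both ends `= height·u + O(u²)`).
-/

namespace Summit.Ventures.CertifiedArithmetic.LowPrec.Opt

open Literature.ComputerArithmetic.JeannerodRump2018
open Literature.ComputerArithmetic.JeannerodRump2018.SumTree
open Literature.ComputerArithmetic.FloatingPoint
open Literature.ComputerArithmetic.FloatingPoint.MiniFloat

/-- R4 (Opt, CM-T T4(e), NEGATIVE): the signed tree-polynomial law ("Conjecture S") is false under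
every restriction `(n-1)u ≤ c`: for every `c > 0` there are a format and an in-range summation tree
of its data with `(n-1)·u ≤ c` and `(1 - 1/M_t(u))·Σ|xᵢ| < |ŝ - s|`. -/
def R4_SignedTreePolyLawFalse : Prop :=
  ∀ c : ℚ, 0 < c → ∃ α : Format, ∃ t : SumTree, TreeInRange α t ∧
    (((leaves t).length : ℚ) - 1) * α.unitRoundoff ≤ c ∧
    (1 - 1 / treeM α.unitRoundoff t) * absLeafSum t < |eval (flα α) t - exact t|

/-- `R4_SignedTreePolyLawFalse` holds. -/
theorem R4_SignedTreePolyLawFalse_holds : R4_SignedTreePolyLawFalse :=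
  signed_law_fails_below_any_threshold

/-- R4 (Opt, CM-T T4(e), POSITIVE — the signed sandwich, upper half): in every format with `m ≥ 1`,
every evaluation tree of data of ANY signs whose nodes stay in range satisfies
`|ŝ - s| ≤ (M_t(v) - 1)·Σ|xᵢ|` with `v = u/(1+u)` — every `n`, no restriction. -/
def R4_SignedTreePolyUpper : Prop :=
  ∀ α : Format, 1 ≤ α.manBits → ∀ t : SumTree, TreeInRange α t →
    |eval (flα α) t - exact t|
      ≤ (treeM (α.unitRoundoff / (1 + α.unitRoundoff)) t - 1) * absSum t

/-- `R4_SignedTreePolyUpper` holds. -/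
theorem R4_SignedTreePolyUpper_holds : R4_SignedTreePolyUpper :=
  fun α hm t ht => abs_eval_sub_exact_le_treeM_format α hm t ht

/-! ## Appended 2026-08-20 (lean seat gen 7): Conjecture S′ at height two, and the inflation-aware height bound -/

/-- R4 (Opt, CM-T T4(e), POSITIVE — Conjecture S′ at height two): in every format with `m ≥ 1`, the
balanced four-leaf tree `((a,b),(c,d))` of data of ANY signs whose three additions stay in range
obeys the signed tree-polynomial law `|ŝ - s| ≤ (1 - 1/M_t(u))·Σ|xᵢ|` (`M_t(u) = (1+u)²`; attained by
nonnegative data, `R4_TreePolyFormats`): the exact signed worst case of this tree IS the law, at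
every precision (`OptTreePolySignedHeightTwo.signed_law_height_two_tree`). -/
def R4_SignedLawHeightTwo : Prop :=
  ∀ α : Format, 1 ≤ α.manBits → ∀ a b c d : ℚ,
    TreeInRange α (node (node (leaf a) (leaf b)) (node (leaf c) (leaf d))) →
    |eval (flα α) (node (node (leaf a) (leaf b)) (node (leaf c) (leaf d)))
        - exact (node (node (leaf a) (leaf b)) (node (leaf c) (leaf d)))|
      ≤ (1 - 1 / treeM α.unitRoundoff (node (node (leaf a) (leaf b)) (node (leaf c) (leaf d))))
          * absSum (node (node (leaf a) (leaf b)) (node (leaf c) (leaf d)))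

/-- `R4_SignedLawHeightTwo` holds. -/
theorem R4_SignedLawHeightTwo_holds : R4_SignedLawHeightTwo :=
  fun α hm a b c d ht => signed_law_height_two_tree α hm a b c d ht

/-- R4 (Opt, CM-T T4(e), POSITIVE — the inflation-aware height bound): in every format with
`m ≥ 1`, every evaluation tree of data of ANY signs whose nodes stay in range satisfies
`|ŝ - s| ≤ max(1 - (1-v)^h, (1+w)^h - 1)·Σ|xᵢ|` with `h` the height, `v = u/(1+u)`,
`w = u/(1+2u+2u²)`; for `h ≤ 2` this is the tree-polynomial law of the balanced tree, and it refines
the signed sandwich `(1+v)^h - 1` of balanced trees at second order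
(`OptTreePolySignedHeight.abs_eval_sub_exact_le_inflation_height`). -/
def R4_SignedInflationHeight : Prop :=
  ∀ α : Format, 1 ≤ α.manBits → ∀ t : SumTree, TreeInRange α t →
    |eval (flα α) t - exact t|
      ≤ max (1 - (1 - α.unitRoundoff / (1 + α.unitRoundoff)) ^ height t)
            ((1 + α.unitRoundoff / (1 + 2 * α.unitRoundoff + 2 * α.unitRoundoff ^ 2))
                ^ height t - 1) * absSum t

/-- `R4_SignedInflationHeight` holds. -/
theorem R4_SignedInflationHeight_holds : R4_SignedInflationHeight :=
  fun α hm t ht => abs_eval_sub_exact_le_inflation_height α hm t ht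

end Summit.Ventures.CertifiedArithmetic.LowPrec.Opt
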